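import Summits.QuantumFields.YangMills.Theorems.LuscherReductionDressedRitzPolyakovLiftStaticsOfSeparationInstances
import HarnessLib

/-!
# Line «polyakovlift» on crux `DressedRitz` (stmt-QuantumFields-20205), stub S-STAT — the REFLECTION-GROUP twirl: a channel even under all three link
# inversions and a channel of vanishing `(ℤ/2)³`-average are exactly uncorrelated (certificate for `A₁`∕`E` channels against ANY member of a rotated `T` level)

Fleet-service module of seat ym-infvol-p1 g6 (route `LuscherReduction`, femto rung R2b1).  The involution constructors of
`…StaticsOfSeparationInstances.lean` certify a pair when the second channel is ODD under ONE reflection; a member of a ROTATED basis of a `T`-type level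
is a mixture `Σ_b q_b t_b` of functions odd under DIFFERENT reflections, so no single involution works — but its average over the abelian reflection group
`{R_ε : ε ∈ (ℤ/2)³}` (`R_ε` inverts the links `μ` with `ε_μ = true`) vanishes, while an `A₁`- or `E`-type channel is even under every `R_ε`.  This file builds
that family as lift symmetries and derives the certificate:

* `linkFlip ε` (`(R_ε V)(x, μ) = V(x, μ)⁻¹` if `ε μ`, else `V(x, μ)`), `linkFlip_eq_comp` (`R_ε = R₀^{ε₀} ∘ R₁^{ε₁} ∘ R₂^{ε₂}` via `axisReflect_one_site_apply`),
  ★ `isLiftSymmetry_linkFlip`, `linkFlip_linkFlip` (involutive);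
* ★★ `pairSeparated_of_reflectionTwirl`: `f` even under every `R_ε` and `Σ_ε h ∘ R_ε = 0` ⟹ `PairSeparated f h` (twirl over `J = Fin 3 → Bool`, `ι = id`,
  weight `1/8`);  `sum_linkFlip_eq_zero_of_odd` (a function odd under one link inversion has zero `(ℤ/2)³`-average — so does any linear mixture of such).

HONEST FRAMING: certificate bookkeeping on the conditional femto rung R2b1; no renormalisation-group content; nothing here bears on infinite volume, the
continuum limit or the Clay gap.  References: M. Lüscher, NPB 219 (1983) 233, §2 [cite: Luscher1983, §2]; M. Lüscher, G. Münster, NPB 232 (1984) 445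
[cite: LuscherMunster1984, §4].
-/

set_option autoImplicit false

noncomputable section

open MeasureTheory Filter Topology
open Literature.MathematicalPhysics.QuantumFieldTheory
open scoped BigOperators

namespace Summit.QuantumFields.YangMills.Theorems.FemtoTransferGap.PolyakovLift

open Summit.QuantumFields.YangMills.Theorems.FemtoTransferGap

/-! ## §1 The reflection group `(ℤ/2)³` on one-site configurations -/

/-- `R_ε`: invert the links `μ` with `ε μ = true` (one-site configurations). [folklore] -/
def linkFlip (ε : Fin 3 → Bool) (V : GaugeConfig 3 1 SU2) : GaugeConfig 3 1 SU2 :=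
  fun e => bif ε e.2 then (V e)⁻¹ else V e

/-- `R_ε` is an involution. [folklore] -/
theorem linkFlip_linkFlip (ε : Fin 3 → Bool) (V : GaugeConfig 3 1 SU2) : linkFlip ε (linkFlip ε V) = V := by
  funext e
  unfold linkFlip
  cases ε e.2 <;> simp

/-- One optional axis reflection: `R_k` if `b`, else the identity. [folklore] -/
def optAxisReflect (k : Fin 3) (b : Bool) (V : GaugeConfig 3 1 SU2) : GaugeConfig 3 1 SU2 :=
  bif b then configPerm (Equiv.swap 0 k) ((configPerm (Equiv.swap 0 k) V).negReflect) else V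

/-- `optAxisReflect k b` evaluated: it inverts the link `k` iff `b`. [folklore] -/
theorem optAxisReflect_apply (k : Fin 3) (b : Bool) (V : GaugeConfig 3 1 SU2) (x : Site 3 1) (μ : Fin 3) :
    optAxisReflect k b V (x, μ) = if b = true ∧ μ = k then (V (x, μ))⁻¹ else V (x, μ) := by
  cases b
  · simp [optAxisReflect]
  · simp only [optAxisReflect, cond_true, axisReflect_one_site_apply, true_and]

/-- Each optional axis reflection is a lift symmetry. [cite: Luscher1983, §2] -/
theorem isLiftSymmetry_optAxisReflect (k : Fin 3) (b : Bool) : IsLiftSymmetry (optAxisReflect k b) := by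
  cases b
  · exact ⟨fun F hF => hF, fun L _ β φ _ _ t F H a c => rfl⟩
  · exact isLiftSymmetry_axisReflect k

/-- **`R_ε = R₀^{ε₀} ∘ R₁^{ε₁} ∘ R₂^{ε₂}`** (pointwise, via `axisReflect_one_site_apply`). [folklore] -/
theorem linkFlip_eq_comp (ε : Fin 3 → Bool) (V : GaugeConfig 3 1 SU2) :
    linkFlip ε V = optAxisReflect 0 (ε 0) (optAxisReflect 1 (ε 1) (optAxisReflect 2 (ε 2) V)) := by
  funext e
  obtain ⟨x, μ⟩ := e
  rw [optAxisReflect_apply, optAxisReflect_apply, optAxisReflect_apply]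
  unfold linkFlip
  fin_cases μ
  · cases h0 : ε 0 <;> simp [h0]
  · cases h1 : ε 1 <;> simp [h1]
  · cases h2 : ε 2 <;> simp [h2]

/-- ★ **Every `R_ε` is a lift symmetry** (composition of axis reflections). [cite: Luscher1983, §2] -/
theorem isLiftSymmetry_linkFlip (ε : Fin 3 → Bool) : IsLiftSymmetry (linkFlip ε) := by
  have h := (isLiftSymmetry_optAxisReflect 0 (ε 0)).comp
    ((isLiftSymmetry_optAxisReflect 1 (ε 1)).comp (isLiftSymmetry_optAxisReflect 2 (ε 2)))
  refine ⟨fun F hF => ?_, fun L _ β φ hφ heig t F H a b => ?_⟩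
  · have e : (fun V => F (linkFlip ε V)) = fun V => F (optAxisReflect 0 (ε 0) (optAxisReflect 1 (ε 1) (optAxisReflect 2 (ε 2) V))) :=
      funext fun V => by rw [linkFlip_eq_comp]
    rw [e]; exact h.1 F hF
  · have eF : (fun V => F (linkFlip ε V)) = fun V => F (optAxisReflect 0 (ε 0) (optAxisReflect 1 (ε 1) (optAxisReflect 2 (ε 2) V))) :=
      funext fun V => by rw [linkFlip_eq_comp]
    have eH : (fun V => H (linkFlip ε V)) = fun V => H (optAxisReflect 0 (ε 0) (optAxisReflect 1 (ε 1) (optAxisReflect 2 (ε 2) V))) :=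
      funext fun V => by rw [linkFlip_eq_comp]
    rw [eF, eH]; exact h.2 L β φ hφ heig t F H a b

/-! ## §2 ★★ The reflection-group twirl certificate -/

/-- ★★ **`f` even under every link inversion `R_ε` and `h` of vanishing `(ℤ/2)³`-average ⟹ `PairSeparated f h`** (twirl over `J = Fin 3 → Bool`, each `R_ε`
an involutive lift symmetry, `ι = id`, weight `1/8`).  Use: `f` an `A₁`- or `E`-type channel (even under all reflections), `h` ANY member of a rotated basis of
a `T`-type level (a mixture of functions each odd under some reflection). [cite: Luscher1983, §2] [cite: LuscherMunster1984, §4] -/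
theorem pairSeparated_of_reflectionTwirl {f h : GaugeConfig 3 1 SU2 → ℝ}
    (hf : ∀ (ε : Fin 3 → Bool) (V : GaugeConfig 3 1 SU2), f (linkFlip ε V) = f V)
    (hh : ∀ V : GaugeConfig 3 1 SU2, ∑ ε : Fin 3 → Bool, h (linkFlip ε V) = 0) : PairSeparated f h := by
  refine Or.inr (Or.inl ⟨Fin 3 → Bool, inferInstance, linkFlip, Equiv.refl _, fun _ => (1 / 8 : ℝ), isLiftSymmetry_linkFlip,
    fun ε V => linkFlip_linkFlip ε V, fun _ => rfl, Or.inl ⟨fun V => ?_, fun V => ?_⟩⟩)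
  · have hcard : (Finset.univ : Finset (Fin 3 → Bool)).card = 8 := by simp [Finset.card_univ]
    simp only [hf, Finset.sum_const, hcard, nsmul_eq_mul]
    ring
  · rw [← Finset.mul_sum, hh, mul_zero]

/-- Flipping one more coordinate of `ε`. [folklore] -/
def flipAt (k : Fin 3) (ε : Fin 3 → Bool) : Fin 3 → Bool := Function.update ε k (!ε k)

/-- `flipAt k` is an involution of `Fin 3 → Bool`. [folklore] -/
theorem flipAt_flipAt (k : Fin 3) (ε : Fin 3 → Bool) : flipAt k (flipAt k ε) = ε := by
  funext j
  unfold flipAt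
  by_cases hj : j = k
  · subst hj; simp
  · simp [Function.update_of_ne hj]

/-- `R_{flipAt k ε} = R_{single k} ∘ R_ε` pointwise: flipping one more axis is one more link inversion. [folklore] -/
theorem linkFlip_flipAt (k : Fin 3) (ε : Fin 3 → Bool) (V : GaugeConfig 3 1 SU2) :
    linkFlip (flipAt k ε) V = linkFlip (Function.update (fun _ => false) k true) (linkFlip ε V) := by
  funext e
  obtain ⟨x, μ⟩ := e
  unfold linkFlip flipAt
  by_cases hμ : μ = k
  · subst hμ
    cases ε μ <;> simp
  · simp [Function.update_of_ne hμ]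

/-- **A function ODD under one link inversion `R_k` has zero `(ℤ/2)³`-average** (pair `ε` with `flipAt k ε`); hence so does every linear mixture of such
functions — e.g. any member of a rotated basis of a `T`-type level. [cite: Luscher1983, §2] -/
theorem sum_linkFlip_eq_zero_of_odd (k : Fin 3) {h : GaugeConfig 3 1 SU2 → ℝ}
    (hodd : ∀ V : GaugeConfig 3 1 SU2, h (linkFlip (Function.update (fun _ => false) k true) V) = -h V) (V : GaugeConfig 3 1 SU2) :
    ∑ ε : Fin 3 → Bool, h (linkFlip ε V) = 0 := by
  -- the involution `flipAt k` on the index set changes the sign of each term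
  have hinv : ∑ ε : Fin 3 → Bool, h (linkFlip ε V) = ∑ ε : Fin 3 → Bool, h (linkFlip (flipAt k ε) V) :=
    (Equiv.sum_comp (Function.Involutive.toPerm (flipAt k) (flipAt_flipAt k)) (fun ε => h (linkFlip ε V))).symm
  have hneg : ∑ ε : Fin 3 → Bool, h (linkFlip (flipAt k ε) V) = -∑ ε : Fin 3 → Bool, h (linkFlip ε V) := by
    rw [← Finset.sum_neg_distrib]
    exact Finset.sum_congr rfl fun ε _ => by rw [linkFlip_flipAt, hodd]
  linarith [hinv.trans hneg]

/-- **Mixtures**: if each `t_b` is odd under some link inversion, every linear combination `Σ_b q_b t_b` has zero `(ℤ/2)³`-average. [cite: Luscher1983, §2] -/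
theorem sum_linkFlip_eq_zero_of_mixture {n : ℕ} (t : Fin n → GaugeConfig 3 1 SU2 → ℝ) (axis : Fin n → Fin 3)
    (hodd : ∀ b V, t b (linkFlip (Function.update (fun _ => false) (axis b) true) V) = -t b V) (q : Fin n → ℝ) (V : GaugeConfig 3 1 SU2) :
    ∑ ε : Fin 3 → Bool, (∑ b, q b * t b (linkFlip ε V)) = 0 := by
  rw [Finset.sum_comm]
  exact Finset.sum_eq_zero fun b _ => by rw [← Finset.mul_sum, sum_linkFlip_eq_zero_of_odd (axis b) (hodd b), mul_zero]

/-- ★ **Certificate for an all-even channel against any mixture of singly-odd channels** (e.g. `A₁`∕`E`-type vs a rotated `T`-level member).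
[cite: Luscher1983, §2] [cite: LuscherMunster1984, §4] -/
theorem pairSeparated_of_even_mixtureOdd {f : GaugeConfig 3 1 SU2 → ℝ} (hf : ∀ (ε : Fin 3 → Bool) (V : GaugeConfig 3 1 SU2), f (linkFlip ε V) = f V)
    {n : ℕ} (t : Fin n → GaugeConfig 3 1 SU2 → ℝ) (axis : Fin n → Fin 3)
    (hodd : ∀ b V, t b (linkFlip (Function.update (fun _ => false) (axis b) true) V) = -t b V) (q : Fin n → ℝ)
    {h : GaugeConfig 3 1 SU2 → ℝ} (hh : ∀ V, h V = ∑ b, q b * t b V) : PairSeparated f h := by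
  refine pairSeparated_of_reflectionTwirl hf fun V => ?_
  simp only [hh]
  exact sum_linkFlip_eq_zero_of_mixture t axis hodd q V

end Summit.QuantumFields.YangMills.Theorems.FemtoTransferGap.PolyakovLift

end
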